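import Summits.Ventures.YMGap.RobustBall.FiniteGibbsAverages
import Literature.Probability.LatticeModels.DobrushinComparison
import HarnessLib

/-!
# RobustBall/FiniteHeatBathDobrushin — Dobrushin's comparison bound for a finite spin system through its
# heat-bath kernels: conditioning on one spin moves local averages by at most `c^{dist} · osc`

HONEST FRAMING: an INSTANCE of the tree's measure-free Dobrushin comparison theorem
(`Literature.Probability.LatticeModels.Dobrushin.DustingData.abs_sub_le_sum_pow`, Friedli–Velenik 2017
Thm. 6.31 / Georgii 2011 Thm. 8.20) for a FINITE spin system `V → S` with a positive weight `w`
(finite sums only), written for the centre-projection area law of track Y2 (cell `pub-ymgap`, seat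
ds-4 g7).  Nothing here is specific to gauge theories; nothing is claimed about any continuum limit.

Contents.
* `hbDusting w C nbr W …` — the dusting data whose averaging operators are the heat-bath operators
  `hb w x`, admissible observables = functions with a finite dependence set, influence matrix `C`
  supported on `nbr`; the one analytic input, the DUSTING ESTIMATE (FV Lemma 6.34)
  `δ_y(hb_x f) ≤ δ_y(f) + C x y · δ_x(f)`, is proved from a total-variation influence hypothesis
  `tv w x σ τ ≤ C x y` for environments `σ, τ` differing only at `y` (`isOscBound_hb`).
* `isInvariantState_avg` — every Gibbs average `avg (g·w)` with `g ≥ 0` blind to the usable sites is an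
  invariant state (finite DLR identity `avg_hb`).
* **`abs_avg_sub_avg_fiber_le`** — the conclusion used downstream: if the rows of `C` sum to `≤ c ≤ 1`
  and `ℓ` is a `C`-Lipschitz profile vanishing at the conditioned site `t`, then for every one-site
  observable `φ(σ_b)` of oscillation `≤ δ₀`,
  `|avg w φ(σ_b) − avg (w|_{σ_t = s}) φ(σ_b)| ≤ c^{ℓ b} · δ₀`.

References: Friedli–Velenik 2017 §6.5.2 (Thm. 6.31, Prop. 6.33, Lemma 6.34); Georgii 2011 Thm. 8.20.
-/

noncomputable section

open Finset Function
open Literature.Probability.LatticeModels Literature.Probability.LatticeModels.Dobrushin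

namespace Summit.Ventures.YMGap.RobustBall.FiniteGibbs

variable {V S : Type*} [Fintype V] [DecidableEq V] [Fintype S] [Nonempty S]

/-! ### The dusting estimate for heat-bath kernels -/

omit [Fintype V] in
/-- **Dusting estimate for the heat-bath operator** (Friedli–Velenik 2017, Lemma 6.34): if `δ` bounds the
oscillations of `f` and the one-site laws at `x` in environments differing only at `y ≠ x` are within
total variation `C x y`, then `hb w x f` has oscillation `0` at `x` and `≤ δ y + C x y · δ x` at `y ≠ x`.
[cite: FriedliVelenik2017, Lemma 6.34] -/
theorem isOscBound_hb {w : (V → S) → ℝ} (hw : ∀ σ, 0 < w σ) {C : V → V → ℝ} (x : V)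
    (htv : ∀ y, y ≠ x → ∀ σ τ : V → S, (∀ z, z ≠ y → σ z = τ z) → tv w x σ τ ≤ C x y)
    {f : (V → S) → ℝ} {δ : V → ℝ} (hδ : IsOscBound f δ) (hC0 : ∀ y, 0 ≤ C x y) :
    IsOscBound (hb w x f) fun y => if y = x then 0 else δ y + C x y * δ x where
  nonneg y := by
    split_ifs
    · exact le_rfl
    · exact add_nonneg (hδ.nonneg y) (mul_nonneg (hC0 y) (hδ.nonneg x))
  le y σ τ hστ := by
    split_ifs with hyx
    · subst hyx
      rw [hb_congr_of_agree f hστ, sub_self, abs_zero]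
    · -- split `hb σ − hb τ` into the `f`-variation and the kernel-variation parts
      have hsplit : hb w x f σ - hb w x f τ =
          ∑ s, hbProb w x σ s * (f (update σ x s) - f (update τ x s)) +
            ∑ s, (hbProb w x σ s - hbProb w x τ s) * f (update τ x s) := by
        simp only [hb, ← Finset.sum_add_distrib, ← Finset.sum_sub_distrib]
        exact Finset.sum_congr rfl fun s _ => by ring
      have h1 : |∑ s, hbProb w x σ s * (f (update σ x s) - f (update τ x s))| ≤ δ y := by
        calc |∑ s, hbProb w x σ s * (f (update σ x s) - f (update τ x s))|
            ≤ ∑ s, |hbProb w x σ s * (f (update σ x s) - f (update τ x s))| := abs_sum_le_sum_abs _ _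
          _ ≤ ∑ s, hbProb w x σ s * δ y := Finset.sum_le_sum fun s _ => by
              rw [abs_mul, abs_of_nonneg (hbProb_nonneg hw x σ s)]
              exact mul_le_mul_of_nonneg_left (hδ.le y _ _ (update_agree_of_agree hστ s))
                (hbProb_nonneg hw x σ s)
          _ = δ y := by rw [← Finset.sum_mul, sum_hbProb hw, one_mul]
      have h2 : |∑ s, (hbProb w x σ s - hbProb w x τ s) * f (update τ x s)| ≤ C x y * δ x := by
        have hg : ∀ s s', f (update τ x s) - f (update τ x s') ≤ δ x := fun s s' =>
          (le_abs_self _).trans (hδ.le x _ _ fun z hz => by rw [update_of_ne hz, update_of_ne hz])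
        exact (abs_sum_sub_mul_le_tv_mul hw x σ τ hg).trans
          (mul_le_mul_of_nonneg_right (htv y hyx σ τ hστ) (hδ.nonneg x))
      rw [hsplit]
      exact (abs_add_le _ _).trans (add_le_add h1 h2)

/-! ### The dusting data of a positive weight -/

/-- **The Dobrushin dusting data of the heat-bath kernels of a positive weight `w`**: admissible
observables = functions with a finite dependence set, averaging operators `hb w x`, influence matrix `C`
(supported on `nbr`, bounding the total-variation influence of one spin on the one-site law at another),
usable sites `W`. [cite: FriedliVelenik2017, §6.5.2] -/
def hbDusting (w : (V → S) → ℝ) (hw : ∀ σ, 0 < w σ) (C : V → V → ℝ) (nbr : V → Finset V) (W : Set V)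
    (hC0 : ∀ x y, 0 ≤ C x y) (hCz : ∀ x y, y ∉ nbr x → C x y = 0)
    (htv : ∀ x y, y ≠ x → ∀ σ τ : V → S, (∀ z, z ≠ y → σ z = τ z) → tv w x σ τ ≤ C x y) :
    DustingData V S where
  P f Δ := DependsOn f (↑Δ : Set V)
  T x f := hb w x f
  C := C
  nbr := nbr
  W := W
  dependsOn_of h := h
  exists_of _ _ _ := ⟨Finset.univ, fun σ τ h => by
    rw [show σ = τ from funext fun i => h i (by simp)]⟩
  C_nonneg := hC0
  C_eq_zero := hCz
  dust x _ _ hδ := isOscBound_hb hw x (htv x) hδ (hC0 x)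

/-- **Gibbs averages are invariant states** of the heat-bath dusting data: `avg ρ` for `ρ = g · w`, `g ≥ 0`
blind to the spins at the usable sites, of positive mass (finite DLR identity). [cite: FriedliVelenik2017, Thm. 6.31] -/
theorem isInvariantState_avg {w : (V → S) → ℝ} (hw : ∀ σ, 0 < w σ) {C : V → V → ℝ} {nbr : V → Finset V}
    {W : Set V} (hC0 : ∀ x y, 0 ≤ C x y) (hCz : ∀ x y, y ∉ nbr x → C x y = 0)
    (htv : ∀ x y, y ≠ x → ∀ σ τ : V → S, (∀ z, z ≠ y → σ z = τ z) → tv w x σ τ ≤ C x y)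
    {ρ g : (V → S) → ℝ} (hρ : ∀ σ, ρ σ = g σ * w σ) (hg0 : ∀ σ, 0 ≤ g σ) (hm : 0 < mass ρ)
    (hg : ∀ x ∈ W, ∀ σ s, g (update σ x s) = g σ) :
    (hbDusting w hw C nbr W hC0 hCz htv).IsInvariantState (avg ρ) where
  le_of_forall_le _ hM := avg_le_of_le (fun σ => by rw [hρ σ]; exact mul_nonneg (hg0 σ) (hw σ).le) hm hM
  ge_of_forall_ge _ hm' := le_avg_of_ge (fun σ => by rw [hρ σ]; exact mul_nonneg (hg0 σ) (hw σ).le) hm hm'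
  apply_T x hx _ := avg_hb hw x hρ (hg x hx) _

/-! ### The comparison bound: conditioning on one spin -/

/-- **Dobrushin comparison for a finite spin system, one-site form.** Let `w > 0` have heat-bath
total-variation influences `≤ C x y` (`C ≥ 0` supported on `nbr`) with row sums `≤ c ≤ 1`, and let
`ℓ : V → ℕ` vanish at `t` and satisfy `ℓ x ≤ ℓ y + 1` for `y ∈ nbr x`, `x ≠ t`.  Then conditioning on
the value of the spin at `t` moves the average of any one-site observable `φ(σ_b)` of oscillation `≤ δ₀`
by at most `c ^ ℓ b · δ₀` (Friedli–Velenik 2017 Thm. 6.31 / Georgii 2011 Thm. 8.20, through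
`Dobrushin.DustingData.abs_sub_le_sum_pow`). [cite: FriedliVelenik2017, Thm. 6.31] -/
theorem abs_avg_sub_avg_fiber_le [DecidableEq S] {w : (V → S) → ℝ} (hw : ∀ σ, 0 < w σ)
    {C : V → V → ℝ} {nbr : V → Finset V} (hC0 : ∀ x y, 0 ≤ C x y)
    (hCz : ∀ x y, y ∉ nbr x → C x y = 0)
    (htv : ∀ x y, y ≠ x → ∀ σ τ : V → S, (∀ z, z ≠ y → σ z = τ z) → tv w x σ τ ≤ C x y)
    {c : ℝ} (hc0 : 0 ≤ c) (hc1 : c ≤ 1) (hrow : ∀ x, ∑ y ∈ nbr x, C x y ≤ c)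
    (t : V) (ℓ : V → ℕ) (hℓt : ℓ t = 0) (hℓ : ∀ x, x ≠ t → ∀ y ∈ nbr x, ℓ x ≤ ℓ y + 1)
    (s₀ : S) (b : V) (φ : S → ℝ) {δ₀ : ℝ} (hφ : ∀ s s', |φ s - φ s'| ≤ δ₀) :
    |avg w (fun σ => φ (σ b)) - avg (fiber w t s₀) (fun σ => φ (σ b))| ≤ c ^ ℓ b * δ₀ := by
  set D := hbDusting w hw C nbr {x | x ≠ t} hC0 hCz htv with hD
  -- the two states
  have h₁ : D.IsInvariantState (avg w) :=
    isInvariantState_avg hw hC0 hCz htv (ρ := w) (g := fun _ => 1) (fun σ => by simp) (fun _ => zero_le_one)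
      (mass_pos_of_pos hw) (fun _ _ _ _ => rfl)
  have h₂ : D.IsInvariantState (avg (fiber w t s₀)) :=
    isInvariantState_avg hw hC0 hCz htv (ρ := fiber w t s₀) (g := fun σ => if σ t = s₀ then 1 else 0)
      (fiber_eq w t s₀) (fun σ => by split_ifs <;> norm_num) (mass_fiber_pos hw t s₀)
      (fun x hx σ s => fiber_indicator_update hx s₀ σ s)
  -- the observable
  have hδ₀ : 0 ≤ δ₀ := (abs_nonneg _).trans (hφ (Classical.arbitrary S) (Classical.arbitrary S))
  have hP : D.P (fun σ => φ (σ b)) {b} := fun σ τ h => by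
    show φ (σ b) = φ (τ b); rw [h b (by simp)]
  have hosc : IsOscBound (fun σ : V → S => φ (σ b)) (fun y => if y = b then δ₀ else 0) := by
    refine ⟨fun y => by split_ifs <;> [exact hδ₀; exact le_rfl], fun y σ τ hστ => ?_⟩
    split_ifs with hyb
    · subst hyb; exact hφ _ _
    · rw [hστ b (Ne.symm hyb), sub_self, abs_zero]
  have hδ0 : ∀ y ∉ ({b} : Finset V), (if y = b then δ₀ else 0) = 0 := fun y hy => by
    rw [Finset.mem_singleton] at hy; exact if_neg hy
  have key := D.abs_sub_le_sum_pow h₁ h₂ hc0 hc1 (fun x _ => hrow x) ℓ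
    (fun y hy => by
      have : y = t := by simpa [hD, hbDusting] using hy
      rw [this, hℓt])
    (fun x hx y hy => hℓ x (by simpa [hD, hbDusting] using hx) y hy) hP hosc hδ0 (ℓ b)
  simpa using key

end Summit.Ventures.YMGap.RobustBall.FiniteGibbs

end
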